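import Literature.Geometry.Kaehler.ComplexTorusHodgeLieAlgebraAbelianSurfaces
import Literature.Geometry.Kaehler.ComplexTorusHodgeLieAlgebraUnitaryMaximal
import HarnessLib

/-!
# The Hodge Lie algebras of abelian surfaces, II: the six types
# `(dim 𝔨, dim 𝔭) ∈ {(1,0), (1,2), (2,0), (2,2), (2,4), (4,6)}`, `dim 𝔥𝔤_ℝ ∈ {1, 2, 3, 4, 6, 10}`

[cite: MoonenZarhin1999LowDim, §2 (2.2) and Prop. (2.4)] [cite: FiteEtAl2012, §3.2 Lemma 3.7]
[cite: Lange2023AbelianVarietiesComplex, §7.3.1 Prop. 7.3.2 (pp. 337–338)]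

Layer `Literature/Geometry/Kaehler`, namespace `Literature.Geometry.Kaehler.ComplexTorus`; lane `lit-hodgefound`
(Track 2 foundations library), Layer A, prover seat p17 (generation 20), FILE 2 of the self-proposed row g20-#1 of
`run/shared/lean/pub/lit-hodgefound/SKELETON.md`.  Sequel, BY NAME, of `ComplexTorusHodgeLieAlgebraAbelianSurfaces`
(g20-#1 FILE 1: for a polarised complex torus of dimension `2`, `(dim 𝔨, dim 𝔭) ∈ {(1,0), (1,2), (2,0), (2,2), (2,4)} ∪ {4} × {2,4,6}`,
`IsRiemannForm.finrank_prod_mem_of_finrank_eq_two`; `dim 𝔨 = 4 ⟹ 𝔭 ≠ 0`, `IsRiemannForm.hodgeCartanP_ne_bot_of_finrank_hodgeIsotropyLie_eq_four`;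
`dim 𝔭 = 6 ⟺ Hg(X) = Sp(V, E)`) and of `ComplexTorusHodgeLieAlgebraUnitaryMaximal` (p17 g19-#1: `𝔲(V, E, J)` is a
maximal subalgebra of `𝔰𝔭(V, E)`, whence **`dim 𝔨 = g² ⟹ dim 𝔭 ∈ {0, g(g+1)}`**,
`IsRiemannForm.finrank_hodgeCartanP_eq_zero_or_eq_of_finrank_hodgeIsotropyLie_eq_sq`).  THEOREMS ONLY: no definition, no
named fact, no instance attribute, net debt 0.  (Split off FILE 1 only because the build of `…UnitaryMaximal` was not yet
available to importers when FILE 1 was filed.)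

## The mathematics and its sources, quoted

Moonen–Zarhin: "**g = 2.** There are four cases. Type I(1): `X` is an abelian surface with `End⁰(X) = ℚ`. Then
`Hg(X) = Sp(V, φ) ≅ Sp_{4,ℚ}`. Type I(2): `End⁰(X) = F` is a real quadratic field. […] `Hg(X) = Res_{F/ℚ} Sp_F(V, ψ)`.
Type II(1): `D = End⁰(X)` is a quaternion algebra over `ℚ`, split at `∞`. […] `Hg(X)` is the algebraic group `U_{D^opp}`.
Type IV(2,1): `End⁰(X) = F` is a quartic CM-field not containing an imaginary quadratic subfield. We have `Hg(X) = U_F`."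
[MoonenZarhin1999LowDim, §2 (2.2)]; with the products of elliptic curves [ibid., §3; §1 "`Hg(Xⁿ) = Hg(X)` acting
diagonally"] the real Hodge Lie algebras of abelian surfaces are `𝔲(1), 𝔲(1)², 𝔰𝔩₂(ℝ), 𝔲(1) ⊕ 𝔰𝔩₂(ℝ), 𝔰𝔩₂(ℝ)², 𝔰𝔭₄(ℝ)`
— Fité–Kedlaya–Rotger–Sutherland's "**Lemma 3.7.** If `G` satisfies the Sato-Tate axioms for `w = 1`, `g = h^{1,0} = h^{0,1} = 2`,
then `G⁰` is conjugate to one of `U(1)`, `SU(2)`, `U(1) × U(1)`, `U(1) × SU(2)`, `SU(2) × SU(2)`, `USp(4)`" [FiteEtAl2012,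
§3.2 Lemma 3.7: "this classification is well-known in the context of Mumford-Tate groups"], of dimensions `1, 3, 2, 4, 6, 10`
with `(dim 𝔨, dim 𝔭) = (1,0), (1,2), (2,0), (2,2), (2,4), (4,6)`.

FILE 1 left the entries `(4,2)`, `(4,4)` in its table.  They are removed here: if `dim 𝔨 = 4 = g²` then `𝔨` is all of
`𝔲(V, E, J) ≅ 𝔲(2)`, and since the isotropy representation of `𝔲(g)` on `T_J 𝔥_g = Sym_g(ℂ)` is irreducible
(g19-#1, after Lange's proof of Prop. 7.3.2 and Besse's Table 3), `𝔭` is `0` or all of `T_J 𝔥_g`, i.e. `dim 𝔭 ∈ {0, 6}`;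
`𝔭 = 0` is excluded by FILE 1 (`𝔥𝔤_ℝ = 𝔨` would be commutative of dimension `4 > g`).  Hence **`dim 𝔨 = 4 ⟺ dim 𝔭 = 6 ⟺
Hg(X) = Sp(V, E) ⟺ dim 𝔥𝔤_ℝ = 10`**, the table shrinks to the six pairs, `dim 𝔥𝔤_ℝ ∈ {1, 2, 3, 4, 6, 10}`, and
`dim 𝔥𝔤_ℝ = 6 ⟺ (dim 𝔨, dim 𝔭) = (2, 4)`, `dim 𝔨 = 2 ⟺ dim 𝔥𝔤_ℝ ∈ {2, 4, 6}`.

## What is proved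

`IsRiemannForm.finrank_hodgeCartanP_eq_six_of_finrank_hodgeIsotropyLie_eq_four`, `IsRiemannForm.finrank_hodgeIsotropyLie_eq_four_iff_of_finrank_eq_two`
(`⟺ Hg(X) = Sp(V, E)`), **`IsRiemannForm.finrank_prod_mem_six_of_finrank_eq_two`** (THE SIX PAIRS),
**`IsRiemannForm.finrank_hodgeGroupLie_mem_six_of_finrank_eq_two`** (`dim 𝔥𝔤_ℝ ∈ {1, 2, 3, 4, 6, 10}`),
`IsRiemannForm.finrank_hodgeGroupLie_ne_eight_of_finrank_eq_two`, `IsRiemannForm.finrank_hodgeGroupLie_eq_six_iff_of_finrank_eq_two`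
(`⟺ (2, 4)`), `IsRiemannForm.finrank_hodgeIsotropyLie_eq_two_iff_of_finrank_eq_two` (`⟺ dim 𝔥𝔤_ℝ ∈ {2, 4, 6}`), and the
`IsAbelianVariety.…` forms.  NOT here: existence of surfaces of each type; `ℚ`-forms; anything arithmetic.

## References

* [MoonenZarhin1999LowDim] B. Moonen, Yu. G. Zarhin, *Hodge classes on abelian varieties of low dimension*, Math. Ann.
  315 (1999) 711–733, §1, §2 (2.2), Prop. (2.4), §3 (held copy `paper:arxiv-math_9901113`, chunks p0002, p0005, p0006).
* [FiteEtAl2012] F. Fité, K. S. Kedlaya, V. Rotger, A. V. Sutherland, *Sato–Tate distributions and Galois endomorphism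
  modules in genus 2*, Compositio Math. 148 (2012) 1390–1442, §3.2 Lemma 3.7, §4.2 (held copy `paper:arxiv-1110.6638`, p0011, p0014).
* K. S. Kedlaya, *Sato–Tate groups of genus 2 curves*, arXiv:1408.6968 (2014), Thm. 3.1 (held copy `paper:arxiv-1408.6968`, p0011).
* [Lange2023AbelianVarietiesComplex] H. Lange, *Abelian Varieties over the Complex Numbers* (2023), §7.3.1 Prop. 7.3.2.
* [Besse1987] A. L. Besse, *Einstein Manifolds* (1987), 7.45 and §7.H Table 3 (7.104).
-/

noncomputable section

open scoped Matrix Real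

open Set Function Module Matrix NormedSpace Complex

namespace Literature.Geometry.Kaehler

namespace ComplexTorus

section SixTypes

variable {ι : Type*} [Fintype ι] [DecidableEq ι] {E : Type*} [NormedAddCommGroup E] [NormedSpace ℂ E]
  {Φ : (ι → ℝ) ≃L[ℝ] E} {η : E [⋀^Fin 2]→L[ℝ] ℝ}

/-- **`g = 2`, `dim 𝔨 = 4 ⟹ dim 𝔭 = 6`**: `𝔨 = 𝔲(V, E, J)` forces `𝔭 ∈ {0, T_J 𝔥₂}` (g19-#1), and `𝔭 ≠ 0` (FILE 1).
[cite: Lange2023AbelianVarietiesComplex, §7.3.1 Prop. 7.3.2 (pp. 337–338)] [cite: Besse1987, 7.45 and §7.H Table 3 (7.104)]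
[cite: MoonenZarhin1999LowDim, §2 (2.2) (Type I(1)) and Prop. (2.4)] -/
theorem IsRiemannForm.finrank_hodgeCartanP_eq_six_of_finrank_hodgeIsotropyLie_eq_four [FiniteDimensional ℂ E]
    (hη : IsRiemannForm Φ η) (hg : finrank ℂ E = 2) (h4 : finrank ℝ (hodgeIsotropyLie Φ) = 4) :
    finrank ℝ (hodgeCartanP Φ) = 6 := by
  rcases hη.finrank_hodgeCartanP_eq_zero_or_eq_of_finrank_hodgeIsotropyLie_eq_sq (by rw [hg, h4]; norm_num)
    with h0 | h
  · exact absurd (Submodule.finrank_eq_zero.1 h0) (hη.hodgeCartanP_ne_bot_of_finrank_hodgeIsotropyLie_eq_four hg h4)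
  · rw [h, hg]

/-- **`g = 2`: `dim 𝔨 = 4 ⟺ Hg(X) = Sp(V, E)`** (`⟺ dim 𝔭 = 6 ⟺ dim 𝔥𝔤_ℝ = 10`).
[cite: Lange2023AbelianVarietiesComplex, §7.3.1 Prop. 7.3.2 (pp. 337–338)] [cite: MoonenZarhin1999LowDim, §2 (2.2) (Type I(1))] -/
theorem IsRiemannForm.finrank_hodgeIsotropyLie_eq_four_iff_of_finrank_eq_two [FiniteDimensional ℂ E]
    (hη : IsRiemannForm Φ η) (hg : finrank ℂ E = 2) :
    finrank ℝ (hodgeIsotropyLie Φ) = 4 ↔ hodgeGroup Φ = spGroup Φ η := by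
  rw [← hη.finrank_hodgeCartanP_eq_six_iff_of_finrank_eq_two hg]
  exact ⟨hη.finrank_hodgeCartanP_eq_six_of_finrank_hodgeIsotropyLie_eq_four hg,
    hη.finrank_hodgeIsotropyLie_eq_four_of_finrank_hodgeCartanP_eq_six hg⟩

/-- **THE SIX TYPES: `(dim_ℝ 𝔨, dim_ℝ 𝔭) ∈ {(1,0), (1,2), (2,0), (2,2), (2,4), (4,6)}` for every polarised complex torus
of dimension `2`** — the real-dimension shadow of `Hg ∈ {U_F, U_F × U_{F'}, U_D ∼ SL₂, U_F × SL₂, Res_{F/ℚ} SL₂ ∼ SL₂², Sp₄}`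
(`𝔥𝔤_ℝ ∈ {𝔲(1), 𝔲(1)², 𝔰𝔩₂(ℝ), 𝔲(1) ⊕ 𝔰𝔩₂(ℝ), 𝔰𝔩₂(ℝ)², 𝔰𝔭₄(ℝ)}`; connected Sato–Tate groups
`U(1), U(1)², SU(2), U(1) × SU(2), SU(2)², USp(4)`), proved without any classification.
[cite: MoonenZarhin1999LowDim, §2 (2.2) and Prop. (2.4); §3] [cite: FiteEtAl2012, §3.2 Lemma 3.7] -/
theorem IsRiemannForm.finrank_prod_mem_six_of_finrank_eq_two [FiniteDimensional ℂ E] (hη : IsRiemannForm Φ η)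
    (hg : finrank ℂ E = 2) :
    (finrank ℝ (hodgeIsotropyLie Φ), finrank ℝ (hodgeCartanP Φ)) ∈
      ({(1, 0), (1, 2), (2, 0), (2, 2), (2, 4), (4, 6)} : Finset (ℕ × ℕ)) := by
  have h := hη.finrank_prod_mem_of_finrank_eq_two hg
  simp only [Finset.mem_insert, Finset.mem_singleton, Prod.mk.injEq] at h ⊢
  by_cases h4 : finrank ℝ (hodgeIsotropyLie Φ) = 4
  · have h6 := hη.finrank_hodgeCartanP_eq_six_of_finrank_hodgeIsotropyLie_eq_four hg h4
    omega
  · omega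

/-- **`dim_ℝ 𝔥𝔤_ℝ ∈ {1, 2, 3, 4, 6, 10}` FOR EVERY ABELIAN SURFACE** (polarised complex torus of dimension `2`): the
dimensions of `𝔲(1), 𝔲(1)², 𝔰𝔩₂(ℝ), 𝔲(1) ⊕ 𝔰𝔩₂(ℝ), 𝔰𝔩₂(ℝ)², 𝔰𝔭₄(ℝ)`, equivalently of
`U(1), U(1)², SU(2), U(1) × SU(2), SU(2)², USp(4)`. [cite: MoonenZarhin1999LowDim, §2 (2.2) and Prop. (2.4)] [cite: FiteEtAl2012, §3.2 Lemma 3.7] -/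
theorem IsRiemannForm.finrank_hodgeGroupLie_mem_six_of_finrank_eq_two [FiniteDimensional ℂ E]
    (hη : IsRiemannForm Φ η) (hg : finrank ℂ E = 2) :
    finrank ℝ (hodgeGroupLie Φ) ∈ ({1, 2, 3, 4, 6, 10} : Finset ℕ) := by
  have h := hη.finrank_prod_mem_six_of_finrank_eq_two hg
  have hsum := finrank_hodgeGroupLie_eq_finrank_hodgeIsotropyLie_add_finrank_hodgeCartanP Φ
  simp only [Finset.mem_insert, Finset.mem_singleton, Prod.mk.injEq] at h ⊢
  omega

/-- `dim 𝔥𝔤_ℝ ∉ {5, 7, 8, 9}` for an abelian surface. [cite: MoonenZarhin1999LowDim, §2 (2.2)] [cite: FiteEtAl2012, §3.2 Lemma 3.7] -/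
theorem IsRiemannForm.finrank_hodgeGroupLie_ne_eight_of_finrank_eq_two [FiniteDimensional ℂ E]
    (hη : IsRiemannForm Φ η) (hg : finrank ℂ E = 2) :
    finrank ℝ (hodgeGroupLie Φ) ≠ 5 ∧ finrank ℝ (hodgeGroupLie Φ) ≠ 7 ∧ finrank ℝ (hodgeGroupLie Φ) ≠ 8 ∧
      finrank ℝ (hodgeGroupLie Φ) ≠ 9 := by
  have h := hη.finrank_hodgeGroupLie_mem_six_of_finrank_eq_two hg
  simp only [Finset.mem_insert, Finset.mem_singleton] at h
  omega

/-- **`dim 𝔥𝔤_ℝ = 6 ⟺ (dim 𝔨, dim 𝔭) = (2, 4)`** for an abelian surface (the `𝔰𝔩₂(ℝ)²` cases: real multiplication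
`Res_{F/ℚ} SL₂`, or `E × E'` non-isogenous without CM). [cite: MoonenZarhin1999LowDim, §2 (2.2) (Type I(2)) and §3]
[cite: FiteEtAl2012, §3.2 Lemma 3.7 (`SU(2) × SU(2)`)] -/
theorem IsRiemannForm.finrank_hodgeGroupLie_eq_six_iff_of_finrank_eq_two [FiniteDimensional ℂ E]
    (hη : IsRiemannForm Φ η) (hg : finrank ℂ E = 2) :
    finrank ℝ (hodgeGroupLie Φ) = 6 ↔ finrank ℝ (hodgeIsotropyLie Φ) = 2 ∧ finrank ℝ (hodgeCartanP Φ) = 4 := by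
  have h := hη.finrank_prod_mem_six_of_finrank_eq_two hg
  have hsum := finrank_hodgeGroupLie_eq_finrank_hodgeIsotropyLie_add_finrank_hodgeCartanP Φ
  simp only [Finset.mem_insert, Finset.mem_singleton, Prod.mk.injEq] at h
  omega

/-- **`dim 𝔨 = 2 ⟺ dim 𝔥𝔤_ℝ ∈ {2, 4, 6}`** for an abelian surface (isotropy a `2`-torus: `𝔲(1)²`, `𝔲(1) ⊕ 𝔰𝔩₂(ℝ)`,
`𝔰𝔩₂(ℝ)²`). [cite: MoonenZarhin1999LowDim, §2 (2.2) and §3] [cite: FiteEtAl2012, §3.2 Lemma 3.7] -/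
theorem IsRiemannForm.finrank_hodgeIsotropyLie_eq_two_iff_of_finrank_eq_two [FiniteDimensional ℂ E]
    (hη : IsRiemannForm Φ η) (hg : finrank ℂ E = 2) :
    finrank ℝ (hodgeIsotropyLie Φ) = 2 ↔
      finrank ℝ (hodgeGroupLie Φ) = 2 ∨ finrank ℝ (hodgeGroupLie Φ) = 4 ∨ finrank ℝ (hodgeGroupLie Φ) = 6 := by
  have h := hη.finrank_prod_mem_six_of_finrank_eq_two hg
  have hsum := finrank_hodgeGroupLie_eq_finrank_hodgeIsotropyLie_add_finrank_hodgeCartanP Φ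
  simp only [Finset.mem_insert, Finset.mem_singleton, Prod.mk.injEq] at h
  omega

/-- `∃`-polarisation form: **every abelian surface has `(dim 𝔨, dim 𝔭) ∈ {(1,0), (1,2), (2,0), (2,2), (2,4), (4,6)}`**.
[cite: MoonenZarhin1999LowDim, §2 (2.2) and Prop. (2.4)] [cite: FiteEtAl2012, §3.2 Lemma 3.7] -/
theorem IsAbelianVariety.finrank_prod_mem_six_of_finrank_eq_two [FiniteDimensional ℂ E] (hX : IsAbelianVariety Φ)
    (hg : finrank ℂ E = 2) :
    (finrank ℝ (hodgeIsotropyLie Φ), finrank ℝ (hodgeCartanP Φ)) ∈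
      ({(1, 0), (1, 2), (2, 0), (2, 2), (2, 4), (4, 6)} : Finset (ℕ × ℕ)) := by
  obtain ⟨η, hη⟩ := hX
  exact hη.finrank_prod_mem_six_of_finrank_eq_two hg

/-- `∃`-polarisation form: **every abelian surface has `dim_ℝ 𝔥𝔤_ℝ ∈ {1, 2, 3, 4, 6, 10}`**.
[cite: MoonenZarhin1999LowDim, §2 (2.2) and Prop. (2.4)] [cite: FiteEtAl2012, §3.2 Lemma 3.7] -/
theorem IsAbelianVariety.finrank_hodgeGroupLie_mem_six_of_finrank_eq_two [FiniteDimensional ℂ E]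
    (hX : IsAbelianVariety Φ) (hg : finrank ℂ E = 2) :
    finrank ℝ (hodgeGroupLie Φ) ∈ ({1, 2, 3, 4, 6, 10} : Finset ℕ) := by
  obtain ⟨η, hη⟩ := hX
  exact hη.finrank_hodgeGroupLie_mem_six_of_finrank_eq_two hg

/-- `∃`-polarisation form: **an abelian surface is Hodge-general for some (every) polarisation iff `dim 𝔨 = 4`**.
[cite: Lange2023AbelianVarietiesComplex, §7.3.1 Prop. 7.3.2 (pp. 337–338)] [cite: MoonenZarhin1999LowDim, §2 (2.2) (Type I(1))] -/
theorem IsAbelianVariety.exists_hodgeGroup_eq_spGroup_iff_finrank_hodgeIsotropyLie_eq_four [FiniteDimensional ℂ E]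
    (hX : IsAbelianVariety Φ) (hg : finrank ℂ E = 2) :
    (∃ η : E [⋀^Fin 2]→L[ℝ] ℝ, IsRiemannForm Φ η ∧ hodgeGroup Φ = spGroup Φ η) ↔
      finrank ℝ (hodgeIsotropyLie Φ) = 4 := by
  obtain ⟨η, hη⟩ := hX
  refine ⟨fun ⟨η', hη', h⟩ ↦ (hη'.finrank_hodgeIsotropyLie_eq_four_iff_of_finrank_eq_two hg).2 h,
    fun h ↦ ⟨η, hη, (hη.finrank_hodgeIsotropyLie_eq_four_iff_of_finrank_eq_two hg).1 h⟩⟩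

end SixTypes

end ComplexTorus

end Literature.Geometry.Kaehler
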